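import Summits.Parity.GeneralizedHardyLittlewood.Theorems.LeeYangFibresCellParityLawKernelDefs
import Summits.Parity.GeneralizedHardyLittlewood.Theorems.LeeYangFibresCellParityLawPrLawTwoAssembly
import Literature.NumberTheory.Sieve.LinearEquationsInPrimesCountSandwich
import HarnessLib

/-!
# Route `LeeYangFibres`, crux `CellParityLaw` (stmt-Parity-14109), line `section-annihilator`:
# the registered stub `stub_geThreeReduce` — the kernel applied

Skeleton v13 (lead c2). This file proves the glue statement

  `GeThreeReduce : EffectiveRoughCellLaw → (∀ t ≥ 1, SectionLevelAt t → KernelReadyAt t) →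
     ∀ t ≥ 1, SectionLevelAt t → RawSectionLawAt t`:

the abstract kernel (effective Bombieri law for the rough `Ω`-cells of one sifted sequence, polynomial rate
`η^κ` in the level deficit) applied to the Bombieri-normalised, localised section sequence whose hypotheses are
supplied by `KernelReadyAt`. Two instances of `KernelReadyAt t` are used for the SAME data: one at
`(A, B₂) = (0, 1)`, only to extract the density constant `L'₀ = L'(t, L, u)` on which the kernel's rate exponent
`κ` depends (the dimension conjuncts do not involve `A, B₂`), and one at `B₂ = ⌈(Bκ+1)/κ⌉ + 1`, `A = A₂ + t + 3`
for the ranges, the Type-I bound and the identifications. For `N ≥ N₀` the kernel's error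
`C (η^κ + (log z)^{-κ} + log(2Λ)/log z) V F + C (log x)^{A₂} R` (`η = 2(log log N)^{-B₂}`, `z = N^{1/u}`,
`Λ = (log N)^{t+2}`, `x = 2LN`, `R = N/(log N)^A`) is below `V F/(log log N)^{Bκ} + N/(log N)^{t+2}`:
`(log z)^{-1} ≤ η`, `η^κ ≤ 2^κ (log log N)^{-Bκ-1}`, `log(2Λ)/log z ≤ u(t+3) log log N/log N`,
`(log x)^{A₂} ≤ (2 log N)^{A₂}`.

References: E. Bombieri, RIMS Kôkyûroku 294 (1977) p. 5 [BombieriRIMS1977]; J. Friedlander, H. Iwaniec,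
Ann. Sc. Norm. Sup. Pisa (4) 5 (1978) §4 [FriedlanderIwaniecPisa1978].
-/

noncomputable section

open scoped BigOperators Topology Classical
open Finset Filter Literature.NumberTheory.Sieve

namespace Summit.Parity.GeneralizedHardyLittlewood.Cruxes.CellParityLaw.SectionAnnihilator

namespace GeThreeReduceAux

/-- `V(z) = ∏_{p<z} (1 - g(p)) ≥ 0` for the section density (`g(p) ≤ 1` at primes). -/
theorem prod_one_sub_sectionDensity_nonneg {t : ℕ} (Ψ : Fin (t + 1) → AffLinForm 1) (i : Fin (t + 1))
    (S : Finset ℕ) (hS : ∀ p ∈ S, p.Prime) : 0 ≤ ∏ p ∈ S, (1 - sectionDensity Ψ i p) :=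
  Finset.prod_nonneg fun p hp =>
    sub_nonneg.mpr (PrLawTwoAssemblyAux.sectionDensity_prime_le_one Ψ i (hS p hp))

/-- The rate bookkeeping: for `ℓℓ ≥ 1`, `κ > 0`, `B₂ κ ≥ Bκ + 1`,
`(2/ℓℓ^{B₂})^κ ≤ 2^κ / (ℓℓ^{Bκ} ℓℓ)`. -/
theorem eta_rpow_le {ℓℓ κ : ℝ} {B₂ Bκ : ℕ} (hℓℓ : 1 ≤ ℓℓ)
    (hB : (Bκ : ℝ) + 1 ≤ (B₂ : ℝ) * κ) :
    (2 / ℓℓ ^ B₂) ^ κ ≤ (2 : ℝ) ^ κ / (ℓℓ ^ Bκ * ℓℓ) := by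
  have hℓℓ0 : 0 < ℓℓ := by linarith
  have hpow0 : 0 < ℓℓ ^ B₂ := pow_pos hℓℓ0 _
  rw [Real.div_rpow (by norm_num) hpow0.le]
  refine div_le_div_of_nonneg_left (Real.rpow_nonneg (by norm_num) κ) (by positivity) ?_
  -- `ℓℓ^{Bκ} ℓℓ = ℓℓ^{Bκ+1} ≤ ℓℓ^{B₂ κ}`
  calc ℓℓ ^ Bκ * ℓℓ = ℓℓ ^ ((Bκ : ℝ) + 1) := by
        rw [Real.rpow_add_one hℓℓ0.ne', Real.rpow_natCast]
    _ ≤ ℓℓ ^ ((B₂ : ℝ) * κ) := Real.rpow_le_rpow_of_exponent_le hℓℓ hB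
    _ = (ℓℓ ^ B₂) ^ κ := by rw [Real.rpow_mul hℓℓ0.le, Real.rpow_natCast]

/-- `(log z)^{-κ} ≤ η^κ` once `(log z)⁻¹ ≤ η` (`log z > 0`, `κ ≥ 0`). -/
theorem log_rpow_neg_le {lz η κ : ℝ} (hlz : 0 < lz) (hκ : 0 ≤ κ) (h : lz⁻¹ ≤ η) :
    lz ^ (-κ) ≤ η ^ κ := by
  rw [Real.rpow_neg hlz.le, ← Real.inv_rpow hlz.le]
  exact Real.rpow_le_rpow (inv_nonneg.mpr hlz.le) h hκ

/-- Eventually `u (log log N)^{B₂} ≤ 2 log N`, i.e. `(log z)⁻¹ = u/log N ≤ η = 2/(log log N)^{B₂}`. -/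
theorem eventually_inv_logz_le_eta (u B₂ : ℕ) :
    ∀ᶠ N : ℕ in atTop, ((1 / (u : ℝ)) * Real.log (N : ℝ))⁻¹ ≤ 2 / Real.log (Real.log (N : ℝ)) ^ B₂ := by
  filter_upwards [PrLawTwoAssemblyAux.eventually_const_mul_loglog_pow_le B₂ (u : ℝ) (Nat.cast_nonneg u),
    PrLawTwoAssemblyAux.eventually_le_loglog 1,
    (Real.tendsto_log_atTop.comp tendsto_natCast_atTop_atTop).eventually_ge_atTop (1 : ℝ)] with N hN hll1 hl1
  have hl1' : (1 : ℝ) ≤ Real.log (N : ℝ) := hl1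
  set ℓ := Real.log (N : ℝ)
  set ℓℓ := Real.log ℓ
  have hℓ0 : 0 < ℓ := by linarith
  have hpow : 0 < ℓℓ ^ B₂ := pow_pos (by linarith) _
  rcases Nat.eq_zero_or_pos u with rfl | hu
  · simp only [Nat.cast_zero, div_zero, zero_mul, inv_zero]; positivity
  have hu0 : (0 : ℝ) < u := by exact_mod_cast hu
  rw [show ((1 / (u : ℝ)) * ℓ)⁻¹ = u / ℓ by field_simp, div_le_div_iff₀ hℓ0 hpow]
  nlinarith

/-- Eventually `2 C u (t+3) (log log N)^{Bκ+1} ≤ log N`, i.e. `C log(2Λ)/log z ≤ (1/2)(log log N)^{-Bκ}`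
with `log (2Λ) ≤ (t+3) log log N`. -/
theorem eventually_lam_term (C : ℝ) (hC : 0 ≤ C) (u t Bκ : ℕ) :
    ∀ᶠ N : ℕ in atTop,
      C * (Real.log (2 * Real.log (N : ℝ) ^ (t + 2)) / ((1 / (u : ℝ)) * Real.log (N : ℝ))) ≤
        1 / 2 / Real.log (Real.log (N : ℝ)) ^ Bκ := by
  filter_upwards [PrLawTwoAssemblyAux.eventually_const_mul_loglog_pow_le (Bκ + 1)
      (2 * C * u * ((t : ℝ) + 3)) (by positivity), PrLawTwoAssemblyAux.eventually_le_loglog 1,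
    (Real.tendsto_log_atTop.comp tendsto_natCast_atTop_atTop).eventually_ge_atTop (1 : ℝ)] with N hN hll1 hl1
  have hl1' : (1 : ℝ) ≤ Real.log (N : ℝ) := hl1
  set ℓ := Real.log (N : ℝ) with hℓ
  set ℓℓ := Real.log ℓ with hℓℓ
  have hℓ0 : 0 < ℓ := by linarith
  have hℓℓ1 : 1 ≤ ℓℓ := hll1
  have hpow : 0 < ℓℓ ^ Bκ := pow_pos (by linarith) _
  -- `log (2 ℓ^{t+2}) = log 2 + (t+2) ℓℓ ≤ (t+3) ℓℓ`
  have hlog2 : Real.log 2 ≤ ℓℓ := by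
    have := Real.log_two_lt_d9; linarith
  have hlam : Real.log (2 * ℓ ^ (t + 2)) ≤ ((t : ℝ) + 3) * ℓℓ := by
    rw [Real.log_mul (by norm_num) (pow_pos hℓ0 _).ne', Real.log_pow, ← hℓℓ]
    push_cast
    nlinarith
  have hlam0 : 0 ≤ Real.log (2 * ℓ ^ (t + 2)) :=
    Real.log_nonneg (by nlinarith [one_le_pow₀ (M₀ := ℝ) (a := ℓ) (n := t + 2) hl1'])
  rcases Nat.eq_zero_or_pos u with rfl | hu
  · simp only [Nat.cast_zero, div_zero, zero_mul, mul_zero]; positivity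
  have hu0 : (0 : ℝ) < u := by exact_mod_cast hu
  have hden : 0 < 1 / (u : ℝ) * ℓ := by positivity
  rw [le_div_iff₀ hpow]
  calc C * (Real.log (2 * ℓ ^ (t + 2)) / (1 / (u : ℝ) * ℓ)) * ℓℓ ^ Bκ
      ≤ C * (((t : ℝ) + 3) * ℓℓ / (1 / (u : ℝ) * ℓ)) * ℓℓ ^ Bκ := by gcongr
    _ = (2 * C * u * ((t : ℝ) + 3) * ℓℓ ^ (Bκ + 1)) / (2 * ℓ) := by
        field_simp
        ring
    _ ≤ ℓ / (2 * ℓ) := by gcongr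
    _ = 1 / 2 := by field_simp

/-- Eventually `C (log (2LN))^{A₂} N/(log N)^{A₂+t+3} ≤ N/(log N)^{t+2}` (`L ≥ 1`). -/
theorem eventually_R_term (C : ℝ) (hC : 0 ≤ C) (L A₂ t : ℕ) (hL : 1 ≤ L) :
    ∀ᶠ N : ℕ in atTop,
      C * Real.log (2 * (L : ℝ) * N) ^ A₂ * ((N : ℝ) / Real.log N ^ (A₂ + t + 3)) ≤
        (N : ℝ) / Real.log N ^ (t + 2) := by
  have hL1 : (1 : ℝ) ≤ L := by exact_mod_cast hL
  filter_upwards [(Real.tendsto_log_atTop.comp tendsto_natCast_atTop_atTop).eventually_ge_atTop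
      (max (Real.log (2 * L)) (max 1 (C * 2 ^ A₂))), eventually_ge_atTop 1] with N hN hN1
  have hN0 : (0 : ℝ) < N := by exact_mod_cast hN1
  have hN1r : (1 : ℝ) ≤ N := by exact_mod_cast hN1
  set ℓ := Real.log (N : ℝ) with hℓ
  have hℓ2L : Real.log (2 * L) ≤ ℓ := le_trans (le_max_left _ _) hN
  have hℓ1 : 1 ≤ ℓ := le_trans (le_trans (le_max_left _ _) (le_max_right _ _)) hN
  have hℓC : C * 2 ^ A₂ ≤ ℓ := le_trans (le_trans (le_max_right _ _) (le_max_right _ _)) hN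
  have hℓ0 : 0 < ℓ := by linarith
  -- `log (2LN) = log 2L + ℓ ≤ 2ℓ`
  have hlogx : Real.log (2 * (L : ℝ) * N) ≤ 2 * ℓ := by
    rw [Real.log_mul (by positivity) hN0.ne', ← hℓ]; linarith
  have hlogx0 : 0 ≤ Real.log (2 * (L : ℝ) * N) := Real.log_nonneg (by nlinarith)
  clear hN1r
  calc C * Real.log (2 * (L : ℝ) * N) ^ A₂ * ((N : ℝ) / ℓ ^ (A₂ + t + 3))
      ≤ C * (2 * ℓ) ^ A₂ * ((N : ℝ) / ℓ ^ (A₂ + t + 3)) := by gcongr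
    _ = (C * 2 ^ A₂) * N / (ℓ ^ (t + 2) * ℓ) := by
        rw [mul_pow, pow_add, pow_add]; field_simp; ring
    _ ≤ ℓ * N / (ℓ ^ (t + 2) * ℓ) := by gcongr
    _ = (N : ℝ) / ℓ ^ (t + 2) := by field_simp

end GeThreeReduceAux

open GeThreeReduceAux PrLawTwoAssemblyAux in
/-- **`stub_geThreeReduce`** (registered stub of skeleton v13, line `section-annihilator`): the kernel
applied, `GeThreeReduce`. -/
theorem stub_geThreeReduce : GeThreeReduce := by
  intro hK hHyp t ht hA L u Bκ hu
  have hR := hHyp t ht hA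
  -- the vacuous case `L = 0`
  rcases Nat.eq_zero_or_pos L with hL0 | hLpos
  · refine ⟨0, fun N _ Ψ hΨ hL K _ _ i => ?_⟩
    have h1 : (1 : ℝ) ≤ (L : ℝ) := one_le_of_affLinSize_le Ψ hΨ hL i
    rw [hL0, Nat.cast_zero] at h1
    exact absurd h1 (by norm_num)
  have hL1 : 1 ≤ L := hLpos
  have hL1r : (1 : ℝ) ≤ L := by exact_mod_cast hL1
  -- the density constant `L'₀` (from the instance `A = 0`, `B₂ = 1`) and the kernel's constants
  obtain ⟨L'₀, M₀, h0⟩ := hR L u 0 1 hu le_rfl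
  obtain ⟨κ, C, A₂, x₀, hκ, hC, hKer⟩ := hK u ((t : ℝ) + 2) L'₀ hu
  -- the working instance: `B₂ κ ≥ Bκ + 1`, `A = A₂ + t + 3`
  set B₂ : ℕ := ⌈((Bκ : ℝ) + 1) / κ⌉₊ + 1 with hB₂
  have hB₂1 : 1 ≤ B₂ := by omega
  have hBκ : (Bκ : ℝ) + 1 ≤ (B₂ : ℝ) * κ := by
    have h1 : ((Bκ : ℝ) + 1) / κ ≤ ⌈((Bκ : ℝ) + 1) / κ⌉₊ := Nat.le_ceil _
    have h2 : ((Bκ : ℝ) + 1) / κ ≤ (B₂ : ℝ) := by rw [hB₂]; push_cast; linarith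
    rwa [div_le_iff₀ hκ] at h2
  set A : ℕ := A₂ + t + 3 with hAdef
  obtain ⟨L'₁, M₁, h1⟩ := hR L u A B₂ hu hB₂1
  -- thresholds
  obtain ⟨N₀, hN₀⟩ := Filter.eventually_atTop.1 ((eventually_inv_logz_le_eta u B₂).and
    ((eventually_lam_term C hC u t Bκ).and ((eventually_R_term C hC L A₂ t hL1).and
    ((eventually_le_loglog (max 1 (4 * C * 2 ^ κ))).and
    ((tendsto_natCast_atTop_atTop.eventually_ge_atTop x₀).and ((eventually_ge_atTop M₀).and
    ((eventually_ge_atTop M₁).and (eventually_ge_atTop 2))))))))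
  refine ⟨N₀, fun N hN Ψ hΨ hL K hK hKN i j' hj' hlt1 hKT hF0 => ?_⟩
  obtain ⟨hinvz, hlamT, hRT, hll, hx₀N, hNM₀, hNM₁, hN2⟩ := hN₀ N hN
  have hN0 : (0 : ℝ) < N := by exact_mod_cast (by omega : 0 < N)
  have hℓ0 : 0 < Real.log (N : ℝ) := Real.log_pos (by exact_mod_cast hN2)
  set ℓℓ := Real.log (Real.log (N : ℝ)) with hℓℓ
  have hℓℓ1 : 1 ≤ ℓℓ := le_trans (le_max_left _ _) hll
  have hℓℓC : 4 * C * 2 ^ κ ≤ ℓℓ := le_trans (le_max_right _ _) hll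
  have hpowκ : 0 < ℓℓ ^ Bκ := pow_pos (by linarith) _
  -- the two instances of the ready sequence
  obtain ⟨-, -, -, -, -, -, -, hIw0, hlow0, -, -, -, -⟩ :=
    h0 N hNM₀ Ψ hΨ hL K hK hKN i j' hj' hlt1 hKT hF0
  obtain ⟨⟨hz1, hz2, hη1, hη2, hΛ1, hΛ2, hw1, hw2⟩, hwt, hsHi, hsLo, hsize, hszlow, hdensLe, -, -,
    hTI, hcell, hsizeF, hdens⟩ := h1 N hNM₁ Ψ hΨ hL K hK hKN i j' hj' hlt1 hKT hF0
  -- `x₀ ≤ x = 2LN`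
  have hx₀ : x₀ ≤ xOf L N := by
    refine le_trans hx₀N ?_
    change (N : ℝ) ≤ 2 * (L : ℝ) * N
    nlinarith
  -- the kernel
  obtain ⟨δ, hδ0, hδ2, hlaw⟩ := hKer (secSeqB Ψ K N u i j') (xOf L N) (zOf N u) (etaOf N B₂) (lamOf N t)
    (wOf N) (rOf N A) hx₀ hz1 hz2 hη1 hη2 hΛ1 hΛ2 hw1 hw2 hwt hsHi hsLo hsize hszlow hdensLe hIw0 hlow0 hTI
  refine ⟨δ, hδ0, hδ2, fun m hm => ?_⟩
  have hm' := hlaw m hm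
  rw [hcell m hm, hsizeF, hdens] at hm'
  refine hm'.trans ?_
  -- notation
  set V : ℝ := ∏ p ∈ Nat.primesBelow ⌈zOf N u⌉₊, (1 - sectionDensity Ψ i p) with hV
  set F : ℝ := (sectionMass Ψ K N u i j' 1 : ℝ) with hFdef
  have hV0 : 0 ≤ V := prod_one_sub_sectionDensity_nonneg Ψ i _ fun p hp => Nat.prime_of_mem_primesBelow hp
  have hF0' : 0 ≤ F := Nat.cast_nonneg _
  have hVF : 0 ≤ V * F := mul_nonneg hV0 hF0'
  -- the three relative error terms
  have hlogz : Real.log (zOf N u) = 1 / (u : ℝ) * Real.log N := by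
    change Real.log ((N : ℝ) ^ ((1 : ℝ) / u)) = _
    rw [Real.log_rpow hN0]
  have hu0 : (0 : ℝ) < u := by exact_mod_cast (by omega : 0 < u)
  have hlogz0 : 0 < Real.log (zOf N u) := by rw [hlogz]; positivity
  have hη : etaOf N B₂ = 2 / ℓℓ ^ B₂ := rfl
  have hηκ : etaOf N B₂ ^ κ ≤ (2 : ℝ) ^ κ / (ℓℓ ^ Bκ * ℓℓ) := by
    rw [hη]; exact eta_rpow_le hℓℓ1 hBκ
  have hzκ : Real.log (zOf N u) ^ (-κ) ≤ etaOf N B₂ ^ κ :=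
    log_rpow_neg_le hlogz0 hκ.le (by rw [hlogz, hη]; exact hinvz)
  have hlam : C * (Real.log (2 * lamOf N t) / Real.log (zOf N u)) ≤ 1 / 2 / ℓℓ ^ Bκ := by
    rw [hlogz]; exact hlamT
  have hrel : C * (etaOf N B₂ ^ κ + Real.log (zOf N u) ^ (-κ) + Real.log (2 * lamOf N t) / Real.log (zOf N u))
      ≤ 1 / ℓℓ ^ Bκ := by
    have h2 : C * (etaOf N B₂ ^ κ + Real.log (zOf N u) ^ (-κ)) ≤ 1 / 2 / ℓℓ ^ Bκ := by
      calc C * (etaOf N B₂ ^ κ + Real.log (zOf N u) ^ (-κ)) ≤ C * (2 * ((2 : ℝ) ^ κ / (ℓℓ ^ Bκ * ℓℓ))) := by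
            apply mul_le_mul_of_nonneg_left _ hC; linarith
        _ = (4 * C * 2 ^ κ) / (2 * (ℓℓ ^ Bκ * ℓℓ)) := by ring
        _ ≤ ℓℓ / (2 * (ℓℓ ^ Bκ * ℓℓ)) := by gcongr
        _ = 1 / 2 / ℓℓ ^ Bκ := by field_simp
    calc C * (etaOf N B₂ ^ κ + Real.log (zOf N u) ^ (-κ) + Real.log (2 * lamOf N t) / Real.log (zOf N u))
        = C * (etaOf N B₂ ^ κ + Real.log (zOf N u) ^ (-κ)) +
            C * (Real.log (2 * lamOf N t) / Real.log (zOf N u)) := by ring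
      _ ≤ 1 / 2 / ℓℓ ^ Bκ + 1 / 2 / ℓℓ ^ Bκ := add_le_add h2 hlam
      _ = 1 / ℓℓ ^ Bκ := by ring
  -- the Type-I term
  have hRterm : C * Real.log (xOf L N) ^ A₂ * rOf N A ≤ (N : ℝ) / Real.log N ^ (t + 2) := hRT
  -- conclusion
  calc C * (etaOf N B₂ ^ κ + Real.log (zOf N u) ^ (-κ) + Real.log (2 * lamOf N t) / Real.log (zOf N u)) *
          (V * F) + C * Real.log (xOf L N) ^ A₂ * rOf N A
      ≤ 1 / ℓℓ ^ Bκ * (V * F) + (N : ℝ) / Real.log N ^ (t + 2) :=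
        add_le_add (mul_le_mul_of_nonneg_right hrel hVF) hRterm
    _ = V * F / Real.log (Real.log N) ^ Bκ + (N : ℝ) / Real.log N ^ (t + 2) := by rw [hℓℓ]; ring

end Summit.Parity.GeneralizedHardyLittlewood.Cruxes.CellParityLaw.SectionAnnihilator

end
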